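import Summits.QuantumFields.QCD.Theses.GaussianLinkFrames

/-!
# Crux `FrameAPrioriBound` (stmt-QuantumFields-17374), line `cube-cofactor`: shared vocabulary of the
# registered stubs (LineDefs)

The DEFINITIONS over which the registered stubs of the line `cube-cofactor` of the crux
`Summit.QuantumFields.QCD.Theses.GaussianLinkFrames.FrameAPrioriBound` (route `GaussianLinkFrames`,
sub-problem `QCD`) are typed — moved into a module so that the skeleton
`Cruxes/FrameAPrioriBound/Lines/cube_cofactor.lean`, the landed stub files
(`Theorems/GaussianLinkFramesFrameAPrioriBound<Stub>.lean`) and the kernel-checked composition share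
ONE copy (precedent: `NestedDissectionSeaCoerciveOfDiluteLineDefs.lean`).  Nothing is asserted: every
declaration is an `abbrev`/`def` of an OBJECT (no `Prop`s, no provenance tags — these are the line's
own bookkeeping objects over the tree's `wilsonDirac`, `spinorLift gammaFive`, `fundamentalRep`,
`haarProbability`, not published notions).

Contents: `SU3` (the colour group), `inCube x v` (the axis-parallel cube `Q₂(x)` of ℓ^∞-radius 2, as a
`Bool`), `touches x y e` (the link `e` has an endpoint in `Q₂(x) ∪ Q₂(y)`), `refit S U W` (links selected
by `S` from `W`, the rest from `U`), `hz U m₀ z = γ₅ D_W(U; m₀, 1) − z` (the shifted Hermitian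
Wilson–Dirac kernel), `haarPi L` (product Haar on all links), `tiltWt S J W = exp Σ_{e∈S} Re tr(W_e J_e†)`
(the partial tilt weight of the product tilted-Haar law of the crux).
-/

noncomputable section

namespace Summit.QuantumFields.QCD.Cruxes.FrameAPrioriBound.CubeCofactor

open scoped BigOperators Matrix
open MeasureTheory Filter Literature.MathematicalPhysics.QuantumFieldTheory
  Literature.MathematicalPhysics.QuantumLattice Literature.Probability.LatticeModels

/-- The colour group. -/
abbrev SU3 : Type := Matrix.specialUnitaryGroup (Fin 3) ℂ

variable {L : ℕ}

/-- `v` lies in the axis-parallel cube `Q₂(x)` of ℓ^∞-radius `2` around `x` (coordinates mod `L`).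
Radius 2, not 1: with `x` two layers deep, the port self-energy cannot build a cavity touching `x`
(for `Q₁` the full Dirichlet elimination of the port-coupled space leaves `x` plus the inward chiral
halves of its 8 neighbours, whose Gram `Σ_n P̄_n ⊗ UU† = 4·1` is link-free by unitarity — an
abstract semi-dark point VISIBLE at `x`, resonant at `z = ((m₀+4) − √((m₀+4)²+16))/2`). -/
def inCube (x v : TorusSite 4 L) : Bool :=
  decide (∀ μ : Fin 4, v μ = x μ ∨ v μ = x μ + 1 ∨ v μ = x μ + 2 ∨ v μ + 1 = x μ ∨ v μ + 2 = x μ)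

/-- The link `e = (site, direction)` touches the two-cube region `Q₂(x) ∪ Q₂(y)`
(at least one endpoint inside; ≤ 3000 links per cube). -/
def touches (x y : TorusSite 4 L) (e : Edge 4 L) : Bool :=
  inCube x e.1 || inCube y e.1 || inCube x (Site.shift e.1 e.2) || inCube y (Site.shift e.1 e.2)

/-- Refit: replace the links selected by `S` by those of `W`, keep `U` elsewhere. -/
abbrev refit (S : Edge 4 L → Bool) (U W : GaugeConfig 4 L SU3) : GaugeConfig 4 L SU3 :=
  fun e => if S e then W e else U e

/-- `H(U) − z` with `H = γ₅ D_W(U; m₀, r = 1)` (fundamental `SU(3)`, `r = 1`). -/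
abbrev hz [NeZero L] (U : GaugeConfig 4 L SU3) (m₀ : ℝ) (z : ℂ) :
    Matrix (TorusSite 4 L × Fin 3 × Fin 4) (TorusSite 4 L × Fin 3 × Fin 4) ℂ :=
  spinorLift gammaFive * wilsonDirac (fundamentalRep (Fin 3)) U m₀ 1 -
    z • (1 : Matrix (TorusSite 4 L × Fin 3 × Fin 4) (TorusSite 4 L × Fin 3 × Fin 4) ℂ)

/-- Product Haar on all links of the torus. -/
abbrev haarPi (L : ℕ) [NeZero L] : Measure (GaugeConfig 4 L SU3) :=
  Measure.pi fun _ : Edge 4 L => haarProbability SU3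

/-- Partial tilt weight `exp Σ_{e ∈ S} Re tr(W_e J_e†)`. -/
abbrev tiltWt [NeZero L] (S : Edge 4 L → Bool) (J : Edge 4 L → Matrix (Fin 3) (Fin 3) ℂ)
    (W : GaugeConfig 4 L SU3) : ℝ :=
  Real.exp (∑ e : Edge 4 L, if S e then (((W e : SU3) : Matrix (Fin 3) (Fin 3) ℂ) * (J e)ᴴ).trace.re
    else 0)

end Summit.QuantumFields.QCD.Cruxes.FrameAPrioriBound.CubeCofactor

end
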